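import Literature.NumberTheory.Rogawski1990.RankOneKappaVertexCoverCM                 -- ★ the tame cover (shape of record), `trace_coe_localNonsplitEquiv`, `isCompact_isOpen_conjGlInt_subgroupOf_unitary`, `GroupTheory.isOpen_coe_comap_of_continuous`
import Literature.NumberTheory.Automorphic.UnitaryTwoRamifiedBoundedElementLevels      -- ★ (this seat): `exists_conj_mem_glInt_or_mem_map_conj_glDiagonal_of_trace_le_one`
import HarnessLib

/-!
# The vertex ∕ edge cover of the compact elements of `U(Φ₂)(L⁺_v)` at ANY ramified non-split place (wild included) — binder `hcov` of the ramified rank-one core assembly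
(Rogawski 1990 Lemma 4.9.3; Labesse–Langlands 1979 §2; Tits 1979 §3.2: bounded subgroups of the ramified `U(1,1)` fix a vertex or an edge midpoint of the tree of `SL₂`)

Topic `NumberTheory/Rogawski1990`; namespace `Literature.NumberTheory.Rogawski1990`.  THEOREMS ONLY (no definition, no instance, no notation, no named fact, no `sorry`).
Cell `pub/hodgecm-mathlib`, crux H413 = `stmt-HodgeConjecture-24833`, line «N6nsGerm», road W′ = «R1LL-WILD» (LEAD T9-25 (b): END-WILD owner F0P3a-p04 (g14); architect
A-p16 (g28)); socket «I-5a-ram-WILD» = the `hsum`∕pieces side of the END layer ★ p843850 at a wild place (`CENSUS-END-WILD.F0P3a-p04g14.md` §1).  HONEST LABEL: HC_CM is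
proved only modulo the printed citations until rung 0 closes; nothing printed is asserted here.

`exists_vertexCover_of_ramified_wild (he) (η) (hη)`: the statement of ★ `exists_vertexCover_of_ramified` (A-p03 ∕ p08 lineage, tame: `h2 : |2|_w = 1`, `hση : σ_w η = −η`)
WITHOUT `h2` and WITHOUT `hση` — `K₂ 0 = U(Φ₂)(𝒪_v)`, `K₂ 1 = e₂⁻¹(U ∩ D_η GL₂(𝒪_w) D_η⁻¹)`, both compact open, and every `g₂` with `v_w(tr g₂) ≤ 1` is conjugate into one of
them.  Proof = the tame transport along ★ `localNonsplitEquiv` verbatim, with the hermitian-lattice step replaced by the tree of `SL₂(L⁺_v)`: ★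
`exists_conj_mem_glInt_or_mem_map_conj_glDiagonal_of_trace_le_one` (ROAD W: ★ p843570 descent, ★ B-p08 `rhoVertexActPlace`, ★ (W2) stabilisers, ★
`exists_glVertexAct_eq_self_or_swap_of_valuation_trace_sq_le`).  So the pieces decomposition ★ `exists_pieces_integral_conj_sub_map_eq_sum` applies at `v ∣ 2` as well.

## References
* [Rogawski1990] J. D. Rogawski, *Automorphic Representations of Unitary Groups in Three Variables* (1990), §4.9 Lemma 4.9.3 p. 56.
* [LabesseLanglands1979] J.-P. Labesse, R. P. Langlands, *L-indistinguishability for SL(2)*, Canad. J. Math. 31 (1979), §2.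
* [Tits1979] J. Tits, *Reductive groups over local fields*, PSPM 33.1 (1979), §2.7, §3.2, §3.9.
* [Serre1980Trees] J.-P. Serre, *Trees* (1980), Ch. II §1.3.
* [Kottwitz1988] R. E. Kottwitz, *Tamagawa numbers* (1988), §2.
* [PlatonovRapinchuk1994] V. Platonov, A. Rapinchuk, *Algebraic Groups and Number Theory* (1994), §5.1.
-/

set_option autoImplicit false

noncomputable section

open scoped WithZero ValuativeRel Matrix MatrixGroups
open Matrix WithZero ValuativeRel NumberField IsDedekindDomain

namespace Literature.NumberTheory.Rogawski1990

open Literature.NumberTheory.Automorphic Literature.NumberTheory.Automorphic.UnitaryGroup Literature.NumberTheory.GaloisRepresentations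

variable (L : Type) [Field L] [NumberField L] [IsCMField L] (v : HeightOneSpectrum (𝓞 ↥(maximalRealSubfield L)))
  (w : PlacesOver L v) (hw : IsCMField.complexConj L • w.1 = w.1)

/-- **THE VERTEX∕EDGE COVER AT ANY RAMIFIED NON-SPLIT PLACE — NO `|2|_w = 1`, NO anti-fixed uniformiser** (binder `hcov` of the ramified core assembly; the WILD twin of ★
`exists_vertexCover_of_ramified`, same statement minus `h2`∕`hση`, `η` ANY uniformiser of `L_w`): two compact open subgroups `K₂ 0 = U(Φ₂)(𝒪_v)` (`= U ∩ GL₂(𝒪_w)` in the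
one-place model) and `K₂ 1 = e₂⁻¹(U ∩ D_η GL₂(𝒪_w) D_η⁻¹)`, `D_η = diag(1, η)`, such that every `g₂` with `v_w(tr g₂) ≤ 1` is `U`-conjugate into `K₂ 0` or `K₂ 1`.  Proof through
the tree of `SL₂(L⁺_v)` (ROAD W): ★ `exists_conj_mem_glInt_or_mem_map_conj_glDiagonal_of_trace_le_one` with the anti-fixed `α` of ★ `exists_units_galAdicCompletionMap_complexConj_eq_neg_of_ramified`
(both dyadic types), transported along ★ `localNonsplitEquiv` exactly as in the tame file. [cite: Tits1979, §2.7, §3.2 and §3.9] [cite: Serre1980Trees, Ch. II §1.3] [cite: Kottwitz1988, §2]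
[cite: Rogawski1990, §4.9 Lemma 4.9.3 p. 56] [cite: PlatonovRapinchuk1994, §5.1] -/
theorem exists_vertexCover_of_ramified_wild (he : v.asIdeal.ramificationIdx' w.1.asIdeal ≠ 1)
    (η : (w.1.adicCompletion L)ˣ) (hη : Valued.v (η : w.1.adicCompletion L) = WithZero.exp (-1 : ℤ)) :
    ∃ K₂ : Fin 2 → Subgroup ((cmDatum L 2 (Matrix.of fun i j : Fin 2 => if i.val + j.val + 1 = 2 then (1 : L) else 0)).Local v),
      K₂ 0 = cmLocalIntegralLevel L 2 (Matrix.of fun i j : Fin 2 => if i.val + j.val + 1 = 2 then (1 : L) else 0) v ∧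
      (∀ g, g ∈ K₂ 0 ↔
        (((localNonsplitEquiv (IsCMField.complexConj L) (Matrix.of fun i j : Fin 2 => if i.val + j.val + 1 = 2 then (1 : L) else 0) (IsCMField.complexConj_ne_one L) w hw) g : ↥(unitaryGroupOfForm (galAdicCompletionMap (L := L) (IsCMField.complexConj L) hw) (placeForm (Matrix.of fun i j : Fin 2 => if i.val + j.val + 1 = 2 then (1 : L) else 0) w.1))) : GL (Fin 2) (w.1.adicCompletion L)) ∈ glInt 2 (w.1.adicCompletion L)) ∧
      (∀ g, g ∈ K₂ 1 ↔
        (((localNonsplitEquiv (IsCMField.complexConj L) (Matrix.of fun i j : Fin 2 => if i.val + j.val + 1 = 2 then (1 : L) else 0) (IsCMField.complexConj_ne_one L) w hw) g : ↥(unitaryGroupOfForm (galAdicCompletionMap (L := L) (IsCMField.complexConj L) hw) (placeForm (Matrix.of fun i j : Fin 2 => if i.val + j.val + 1 = 2 then (1 : L) else 0) w.1))) : GL (Fin 2) (w.1.adicCompletion L)) ∈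
          (glInt 2 (w.1.adicCompletion L)).map (MulAut.conj (glDiagonal 2 (w.1.adicCompletion L) ![1, η])).toMonoidHom) ∧
      (∀ ε, IsOpen (K₂ ε : Set ((cmDatum L 2 (Matrix.of fun i j : Fin 2 => if i.val + j.val + 1 = 2 then (1 : L) else 0)).Local v))) ∧
      (∀ ε, IsCompact (K₂ ε : Set ((cmDatum L 2 (Matrix.of fun i j : Fin 2 => if i.val + j.val + 1 = 2 then (1 : L) else 0)).Local v))) ∧
      ∀ g₂ : (cmDatum L 2 (Matrix.of fun i j : Fin 2 => if i.val + j.val + 1 = 2 then (1 : L) else 0)).Local v,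
        Valued.v (((g₂.val.val : Matrix (Fin 2) (Fin 2) (LocalRing L v)).trace) w) ≤ 1 →
          ∃ (ε : Fin 2) (y : (cmDatum L 2 (Matrix.of fun i j : Fin 2 => if i.val + j.val + 1 = 2 then (1 : L) else 0)).Local v), y⁻¹ * g₂ * y ∈ K₂ ε := by
  -- the one-place model, re-typed on the `cmDatum` carrier (as in the tame file)
  obtain ⟨E₂, hE₂⟩ : ∃ E₂ : (cmDatum L 2 (Matrix.of fun i j : Fin 2 => if i.val + j.val + 1 = 2 then (1 : L) else 0)).Local v ≃ₜ* ↥(unitaryGroupOfForm (galAdicCompletionMap (L := L) (IsCMField.complexConj L) hw) (placeForm (Matrix.of fun i j : Fin 2 => if i.val + j.val + 1 = 2 then (1 : L) else 0) w.1)),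
      ∀ g, ((E₂ g : ↥(unitaryGroupOfForm (galAdicCompletionMap (L := L) (IsCMField.complexConj L) hw) (placeForm (Matrix.of fun i j : Fin 2 => if i.val + j.val + 1 = 2 then (1 : L) else 0) w.1))) : GL (Fin 2) (w.1.adicCompletion L)) = (((localNonsplitEquiv (IsCMField.complexConj L) (Matrix.of fun i j : Fin 2 => if i.val + j.val + 1 = 2 then (1 : L) else 0) (IsCMField.complexConj_ne_one L) w hw) g : ↥(unitaryGroupOfForm (galAdicCompletionMap (L := L) (IsCMField.complexConj L) hw) (placeForm (Matrix.of fun i j : Fin 2 => if i.val + j.val + 1 = 2 then (1 : L) else 0) w.1))) : GL (Fin 2) (w.1.adicCompletion L)) :=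
    ⟨(localNonsplitEquiv (IsCMField.complexConj L) (Matrix.of fun i j : Fin 2 => if i.val + j.val + 1 = 2 then (1 : L) else 0) (IsCMField.complexConj_ne_one L) w hw), fun _ => rfl⟩
  have hK1 := isCompact_isOpen_conjGlInt_subgroupOf_unitary L v w hw (placeForm (Matrix.of fun i j : Fin 2 => if i.val + j.val + 1 = 2 then (1 : L) else 0) w.1) (glDiagonal 2 (w.1.adicCompletion L) ![1, η])
  refine ⟨![cmLocalIntegralLevel L 2 (Matrix.of fun i j : Fin 2 => if i.val + j.val + 1 = 2 then (1 : L) else 0) v,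
      ((((glInt 2 (w.1.adicCompletion L)).map (MulAut.conj (glDiagonal 2 (w.1.adicCompletion L) ![1, η])).toMonoidHom).subgroupOf (unitaryGroupOfForm (galAdicCompletionMap (L := L) (IsCMField.complexConj L) hw) (placeForm (Matrix.of fun i j : Fin 2 => if i.val + j.val + 1 = 2 then (1 : L) else 0) w.1))).comap E₂.toMulEquiv.toMonoidHom)],
    rfl, fun g => mem_localIntegralLevel_iff_of_smul_eq (IsCMField.complexConj L) 2 (Matrix.of fun i j : Fin 2 => if i.val + j.val + 1 = 2 then (1 : L) else 0) (IsCMField.complexConj_ne_one L) w hw g,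
    fun g => ?_, fun ε => ?_, fun ε => ?_, fun g₂ hg₂ => ?_⟩
  · simp only [Matrix.cons_val_one, Matrix.cons_val_zero, Subgroup.mem_comap, Subgroup.mem_subgroupOf]
    rw [← hE₂ g]; rfl
  · fin_cases ε
    · exact (isCompact_isOpen_cmLocalIntegralLevel L 2 (Matrix.of fun i j : Fin 2 => if i.val + j.val + 1 = 2 then (1 : L) else 0) v).2
    · exact Literature.GroupTheory.isOpen_coe_comap_of_continuous E₂.toMulEquiv.toMonoidHom E₂.continuous _ hK1.2
  · fin_cases ε
    · exact (isCompact_isOpen_cmLocalIntegralLevel L 2 (Matrix.of fun i j : Fin 2 => if i.val + j.val + 1 = 2 then (1 : L) else 0) v).1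
    · exact Literature.GroupTheory.isCompact_coe_comap_continuousMulEquiv E₂ _ hK1.1
  · -- THE NEW STEP: the tree of `SL₂(L⁺_v)` instead of hermitian lattices
    have htr : Valued.v ((((E₂ g₂ : ↥(unitaryGroupOfForm (galAdicCompletionMap (L := L) (IsCMField.complexConj L) hw) (placeForm (Matrix.of fun i j : Fin 2 => if i.val + j.val + 1 = 2 then (1 : L) else 0) w.1))) : GL (Fin 2) (w.1.adicCompletion L)) : Matrix (Fin 2) (Fin 2) (w.1.adicCompletion L))).trace ≤ 1 := by
      rw [hE₂, trace_coe_localNonsplitEquiv L v w hw _ g₂]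
      exact hg₂
    -- an anti-fixed `α` of either type, a uniformiser of `L⁺_v`
    obtain ⟨α, hα, hvα⟩ := exists_units_galAdicCompletionMap_complexConj_eq_neg_of_ramified L w hw he
    obtain ⟨π, hπ⟩ := IsDedekindDomain.HeightOneSpectrum.valuation_exists_uniformizer (↥(maximalRealSubfield L)) v
    have hϖF : Valued.v (π : v.adicCompletion ↥(maximalRealSubfield L)) = WithZero.exp (-1 : ℤ) := SymplecticCartan.valued_coe_uniformizer v hπ
    obtain ⟨y', hy'⟩ := exists_conj_mem_glInt_or_mem_map_conj_glDiagonal_of_trace_le_one L w hw hα α.ne_zero hϖF he hvα η hη (E₂ g₂) htr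
    -- transport the conjugator back to the `cmDatum` carrier
    have hyy : E₂ ((E₂.symm y')⁻¹ * g₂ * E₂.symm y') = y'⁻¹ * E₂ g₂ * y' := by
      rw [map_mul, map_mul, map_inv, ContinuousMulEquiv.apply_symm_apply]
    rcases hy' with hk | hk
    · refine ⟨0, E₂.symm y', ?_⟩
      simp only [Matrix.cons_val_zero]
      refine (mem_localIntegralLevel_iff_of_smul_eq (IsCMField.complexConj L) 2 (Matrix.of fun i j : Fin 2 => if i.val + j.val + 1 = 2 then (1 : L) else 0) (IsCMField.complexConj_ne_one L) w hw _).2 ?_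
      rw [← hE₂, hyy]
      exact hk
    · refine ⟨1, E₂.symm y', ?_⟩
      simp only [Matrix.cons_val_one, Matrix.cons_val_zero, Subgroup.mem_comap, Subgroup.mem_subgroupOf]
      have hval : ((E₂.toMulEquiv.toMonoidHom ((E₂.symm y')⁻¹ * g₂ * E₂.symm y') : ↥(unitaryGroupOfForm (galAdicCompletionMap (L := L) (IsCMField.complexConj L) hw) (placeForm (Matrix.of fun i j : Fin 2 => if i.val + j.val + 1 = 2 then (1 : L) else 0) w.1))) : GL (Fin 2) (w.1.adicCompletion L)) =
          ((y'⁻¹ * E₂ g₂ * y' : ↥(unitaryGroupOfForm (galAdicCompletionMap (L := L) (IsCMField.complexConj L) hw) (placeForm (Matrix.of fun i j : Fin 2 => if i.val + j.val + 1 = 2 then (1 : L) else 0) w.1))) : GL (Fin 2) (w.1.adicCompletion L)) := by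
        rw [← hyy]; rfl
      rw [hval]
      exact hk

end Literature.NumberTheory.Rogawski1990
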